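import Mathlib
import HarnessLib
import Literature.MathematicalPhysics.QuantumLattice.HubbardDiagonalQuadraticResummation
import Literature.MathematicalPhysics.QuantumLattice.GrassmannKernelAntisymmetry
import Summits.HubbardSuperconductivity.HubbardSuperconductivity.Theorems.KLProgrammeKLRegimeWickPairKernelDefs

/-!
# Route `KLProgramme` — crux K3, ENGINE child gen 6 (stmt-HubbardSuperconductivity-20236 `KLRegimeEngineV16`), stub `stub_engine_step_values`,
# conjunct (E2-v10): DRESSED LINES — the two-leg part of the input action resummed into the step covariance (organisation (R1′))

Cell gate-hubbard-kl, seat hubbard-kl-p1 (g10; (E2) Wick-toolkit lane).  The S62 / Σ-chain classes of the one-slice step carry the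
self-energy dressing of the Cooper bubble and fit no gained (E2-v10) token (E2-SIGMA-DRESSING, evidence #28 on 20236; k3c1-p1 g7 concurs and
adds the twin one-line term at internal indices).  Cure (R1′), ruled a COMMON row of the K3-FLOW table (plan g16 (R25)(3)): absorb the
input action's full two-leg part into the step covariance.  The generic tool is `effAction_sub_quadratic` (p520617) and its normal-form instance
`effAction_normalCovariance_add_diagQuadratic` (p521577).  This file supplies the model-side plumbing the (E2-v10) prover needs to CALL it:

* §1 `kernel_two_sub_presented_kernel_two` (generic): `W − presented (kernel W 2)` has NO two-leg kernel — subtracting the presented two-leg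
  part removes every two-leg vertex from the expansion (kernels are antisymmetric, `kernel_presented`);
* §2 `presented_kernel_two_eq_sum_of_twoLeg`: for a `W` whose two-leg kernels pair only reciprocal labels (the selection rules of
  `kernel_two_plus/minus_eq_zero(_of_conserving)`), the presented two-leg part IS a diagonal quadratic vertex
  `Σ_{kσ} κ_W(k,σ)·ψ̂⁺_{kσ}ψ̂⁻_{kσ}` with `κ_W(k,σ) = 2·kernel W 2 (ψ̂⁺_{kσ}, ψ̂⁻_{kσ})` (`= Σ_W(k,σ)/(βL²)`, `two_mul_kernel_two_eq_selfEnergy_div`)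
  — the `hQ` of `effAction_normalCovariance_add_diagQuadratic`;
* §3 `contr_normalCovariance_eq_diagContr`: a normal covariance with SPIN-INDEPENDENT symbol `p(k,σ) = q(k)` is a diagonal line,
  `contr ℂ (normalCovariance p) = diagContr q` — so the DRESSED step covariance `normalCovariance (p/(1 + pκ))` (spin-independent `κ`) is again a
  diagonal line with value `q/(1 + qκ)` (`contr_normalCovariance_dress_eq_diagContr`), and EVERY landed channel identity
  (`bubbleSum_pp/phDirect/phCrossed_*`, `vertexFn_dblFold_bubble_*`, `klws_source_split`, …, all stated for `contr Cᵢ = diagContr ℓᵢ`) applies to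
  the dressed lines VERBATIM;
* §4 **`effAction_normalCovariance_add_twoLegPart`**: for `C = normalCovariance p`, any `W` obeying the two-leg selection rules, `V′` without
  constant part, `1 + p·κ_W ≠ 0` and unit partition functions:
  `effAction C (V′ + presented (kernel W 2)) = effAction C (presented (kernel W 2)) + S_m (effAction (normalCovariance (p/(1 + pκ_W))) V′)`,
  `m = (1 + pκ_W)⁻¹` — with `V′ := 𝒱^{(n−1)} − presented (kernel 𝒱^{(n−1)} 2)` (§1: no two-leg vertex) this is the dressed one-slice step:
  no `𝒲₂` vertex in any graph, dressed diagonal lines, external legs scaled by `m` (`kernel_map_mulLeft`; `m = 1` off the slice support).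

Exact algebra; nothing about sizes or superconductivity is asserted.  0 kit.
-/

noncomputable section

namespace Summit.HubbardSuperconductivity.HubbardSuperconductivity.Theorems.KLRegimeWick

set_option linter.dupNamespace false -- summit = problem name (single-conjunct summit), D-0017

open Literature.MathematicalPhysics.QuantumLattice GrassmannAlgebra Finset Matrix
open Literature.Probability.LatticeModels

/-! ## §1 Subtracting the presented two-leg part kills the two-leg kernel (generic) -/

section Generic

variable {R : Type*} [CommRing R] [Algebra ℚ R] {Γ : Type*} [Fintype Γ] [DecidableEq Γ]

/-- The kernel of the presented `m`-kernel of `W` is the `m`-kernel of `W` (kernels are already antisymmetric). -/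
theorem kernel_presented_kernel (W : GrassmannAlgebra R Γ) (m : ℕ) (X : Fin m → Γ) :
    kernel R (presented R (kernel R W m)) m X = kernel R W m X := by
  rw [kernel_presented]
  have hσ : ∀ σ : Equiv.Perm (Fin m), Equiv.Perm.sign σ • kernel R W m (X ∘ σ) = kernel R W m X := by
    intro σ
    rw [Literature.MathematicalPhysics.QuantumLattice.kernel_comp_perm R W m X σ, Units.smul_def, zsmul_eq_mul, ← mul_assoc,
      ← Int.cast_mul, ← Units.val_mul, Int.units_mul_self, Units.val_one, Int.cast_one, one_mul]
  simp only [hσ, Finset.sum_const, Finset.card_univ, Fintype.card_perm, Fintype.card_fin, nsmul_eq_mul]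
  rw [← mul_assoc]
  have hfac : ((m.factorial : ℚ)⁻¹ • (1 : R)) * ((m.factorial : ℕ) : R) = 1 := by
    have h1 : ((m.factorial : ℕ) : R) = algebraMap ℚ R (m.factorial : ℚ) := by rw [map_natCast]
    rw [Algebra.smul_def, mul_one, h1, ← map_mul, inv_mul_cancel₀ (Nat.cast_ne_zero.2 (Nat.factorial_ne_zero m)), map_one]
  rw [hfac, one_mul]

/-- **`W − presented (kernel W 2)` has no two-leg kernel.**  Subtracting the presented two-leg part of an element removes every two-leg vertex
from its expansion. -/
theorem kernel_two_sub_presented_kernel_two (W : GrassmannAlgebra R Γ) (X : Fin 2 → Γ) :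
    kernel R (W - presented R (kernel R W 2)) 2 X = 0 := by
  rw [sub_eq_add_neg, kernel_add, ← neg_one_smul R (presented R (kernel R W 2)), kernel_smul, kernel_presented_kernel]
  ring

omit [Algebra ℚ R] in
/-- `presented (kernel W 2)` has no constant part. -/
theorem constPart_presented_two (φ : (Fin 2 → Γ) → R) : constPart R (presented R φ) = 0 := by
  rw [presented, map_sum]
  refine Finset.sum_eq_zero fun Y _ => ?_
  rw [map_smul, genProd_succ, map_mul, constPart_gen, zero_mul, smul_zero]

end Generic

/-! ## §2 The presented two-leg part of a conserving action is a diagonal quadratic vertex -/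

section Model

variable {L M : ℕ} [NeZero L]

omit [NeZero L] in
/-- `ψ(A)ψ(B)` as a `genProd`. -/
theorem genProd_two (A B : HubbardFieldIdx L M) : genProd ℂ ![A, B] = gen ℂ A * gen ℂ B := by
  rw [genProd_succ, genProd_succ, genProd_zero, mul_one]
  rfl

/-- **The presented two-leg part is diagonal**: if the two-leg kernels of `W` pair only reciprocal labels
(`kernel W 2 (ψ̂⁺_{pσ}, Y) = 0` unless `Y = ψ̂⁻_{pσ}`, `kernel W 2 (ψ̂⁻_{pσ}, Y) = 0` unless `Y = ψ̂⁺_{pσ}` — the selection rules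
`kernel_two_plus/minus_eq_zero(_of_conserving)`), then
`presented (kernel W 2) = Σ_{kσ} (2·kernel W 2 (ψ̂⁺_{kσ}, ψ̂⁻_{kσ})) · ψ̂⁺_{kσ}ψ̂⁻_{kσ}`. -/
theorem presented_kernel_two_eq_sum_of_twoLeg (W : HubbardGrassmann L M)
    (hplus : ∀ (p : FreqMomentum L M) (σ : Fin 2) (Y : HubbardFieldIdx L M), Y ≠ ((p, σ), 1) → kernel ℂ W 2 ![((p, σ), 0), Y] = 0)
    (hminus : ∀ (p : FreqMomentum L M) (σ : Fin 2) (Y : HubbardFieldIdx L M), Y ≠ ((p, σ), 0) → kernel ℂ W 2 ![((p, σ), 1), Y] = 0) :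
    presented ℂ (kernel ℂ W 2) =
      ∑ ks : FreqMomentum L M × Fin 2, (2 * kernel ℂ W 2 ![((ks, 0) : HubbardFieldIdx L M), (ks, 1)]) •
        (gen ℂ ((ks, 0) : HubbardFieldIdx L M) * gen ℂ ((ks, 1) : HubbardFieldIdx L M)) := by
  rw [presented]
  -- sum over `Y : Fin 2 → Γ` as a sum over pairs `(Y 0, Y 1)`
  rw [← (finTwoArrowEquiv (HubbardFieldIdx L M)).symm.sum_comp]
  simp only [finTwoArrowEquiv_symm_apply]
  rw [Fintype.sum_prod_type]
  -- the inner sum over `Y 1` collapses by the selection rules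
  have hrow : ∀ A : HubbardFieldIdx L M,
      ∑ B : HubbardFieldIdx L M, kernel ℂ W 2 ![A, B] • genProd ℂ ![A, B] =
        if A.2 = 0 then kernel ℂ W 2 ![A, (A.1, 1)] • (gen ℂ A * gen ℂ (A.1, 1))
        else kernel ℂ W 2 ![A, (A.1, 0)] • (gen ℂ A * gen ℂ (A.1, 0)) := by
    rintro ⟨⟨p, σ⟩, c⟩
    by_cases hc : c = 0
    · subst hc
      rw [if_pos rfl, Finset.sum_eq_single (((p, σ), 1) : HubbardFieldIdx L M)]
      · rw [genProd_two]
      · intro B _ hB; rw [hplus p σ B hB, zero_smul]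
      · intro h; exact absurd (Finset.mem_univ _) h
    · obtain rfl : c = 1 := by
        rcases Fin.exists_fin_two.mp ⟨c, rfl⟩ with h | h
        · exact absurd h hc
        · exact h
      rw [if_neg one_ne_zero, Finset.sum_eq_single (((p, σ), 0) : HubbardFieldIdx L M)]
      · rw [genProd_two]
      · intro B _ hB; rw [hminus p σ B hB, zero_smul]
      · intro h; exact absurd (Finset.mem_univ _) h
  simp only [hrow]
  -- reorganise the outer sum over `A = ((k,σ), c)` by the charge `c`
  rw [Fintype.sum_prod_type]
  refine Finset.sum_congr rfl fun ks _ => ?_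
  simp only [Fin.sum_univ_two, Fin.isValue, if_true, one_ne_zero, if_false]
  -- the reversed pair: kernel and monomial both change sign
  have hk : kernel ℂ W 2 ![((ks, 1) : HubbardFieldIdx L M), (ks, 0)] = -kernel ℂ W 2 ![((ks, 0) : HubbardFieldIdx L M), (ks, 1)] := by
    have h := Literature.MathematicalPhysics.QuantumLattice.kernel_comp_perm ℂ W 2
      (![((ks, 0) : HubbardFieldIdx L M), (ks, 1)]) (Equiv.swap (0 : Fin 2) 1)
    have hcomp : (![((ks, 0) : HubbardFieldIdx L M), (ks, 1)] ∘ (Equiv.swap (0 : Fin 2) 1)) = ![((ks, 1) : HubbardFieldIdx L M), (ks, 0)] := by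
      funext i; fin_cases i <;> rfl
    rw [hcomp, Equiv.Perm.sign_swap (by decide)] at h
    rw [h]
    simp
  have hg : gen ℂ ((ks, 1) : HubbardFieldIdx L M) * gen ℂ ((ks, 0) : HubbardFieldIdx L M) =
      -(gen ℂ ((ks, 0) : HubbardFieldIdx L M) * gen ℂ ((ks, 1) : HubbardFieldIdx L M)) := gen_mul_gen ℂ _ _
  rw [hk, hg, smul_neg, neg_smul, neg_neg, ← add_smul, ← two_mul]

/-- **`κ_W = Σ_W/(βL²)`**: `2·kernel W 2 (ψ̂⁺_{kσ}, ψ̂⁻_{kσ}) = selfEnergy W (k,σ) / (βL²)` (`β ≠ 0`). -/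
theorem two_mul_kernel_two_eq_selfEnergy_div {β : ℝ} (hβ : β ≠ 0) (W : HubbardGrassmann L M) (k : FreqMomentum L M) (σ : Fin 2) :
    2 * kernel ℂ W 2 ![((k, σ), 0), ((k, σ), 1)] = selfEnergy L M β W k σ / ((β * (L : ℝ) ^ 2 : ℝ) : ℂ) := by
  have hL : (L : ℝ) ≠ 0 := Nat.cast_ne_zero.2 (NeZero.ne L)
  have hb : (((β * (L : ℝ) ^ 2 : ℝ) : ℂ)) ≠ 0 := by exact_mod_cast mul_ne_zero hβ (pow_ne_zero 2 hL)
  rw [selfEnergy, vertexFn_def, eq_div_iff hb]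
  push_cast
  simp only [Nat.factorial_two, Nat.cast_ofNat, pow_one]
  ring

/-! ## §3 Normal covariances with spin-independent symbol are diagonal lines -/

omit [NeZero L] in
/-- **A normal covariance with spin-independent symbol is a diagonal line**: `contr ℂ (normalCovariance (fun (k,σ) ↦ q k)) = diagContr q`. -/
theorem contr_normalCovariance_eq_diagContr (q : FreqMomentum L M → ℂ) :
    contr ℂ (normalCovariance L M fun ks => q ks.1) = diagContr L M q := by
  refine contr_eq_diagContr (fun p σ Z hZ => ?_) (fun p σ Y hY => ?_) (fun p σ => ?_)
  · rw [contr_apply, normalCovariance_apply, normalCovariance_apply]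
    rcases Z with ⟨ks, c⟩
    by_cases h : ks = (p, σ)
    · subst h
      have hc : c ≠ 0 := fun hc => hZ (by rw [hc])
      obtain rfl : c = 1 := by
        rcases Fin.exists_fin_two.mp ⟨c, rfl⟩ with h | h
        · exact absurd h hc
        · exact h
      simp
    · rw [if_neg h, if_neg (Ne.symm h)]; simp
  · rw [contr_apply, normalCovariance_apply, normalCovariance_apply]
    rcases Y with ⟨ks, c⟩
    by_cases h : ks = (p, σ)
    · subst h
      have hc : c ≠ 1 := fun hc => hY (by rw [hc])
      obtain rfl : c = 0 := by
        rcases Fin.exists_fin_two.mp ⟨c, rfl⟩ with h | h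
        · exact h
        · exact absurd h hc
      simp
    · rw [if_neg h, if_neg (Ne.symm h)]; simp
  · rw [contr_apply, normalCovariance_apply, normalCovariance_apply]
    simp only [if_true, Fin.isValue, one_ne_zero, zero_ne_one, and_self, if_false]
    rw [sub_neg_eq_add, half_smul_one_mul_add_self]

omit [NeZero L] in
/-- **The dressed normal covariance is a diagonal line**: for spin-independent `q, c`,
`contr ℂ (normalCovariance (fun (k,σ) ↦ q k / (1 + q k·c k))) = diagContr (fun k ↦ q k / (1 + q k·c k))` — the dressed lines of (R1′) enter
every landed channel identity through `diagContr`. -/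
theorem contr_normalCovariance_dress_eq_diagContr (q c : FreqMomentum L M → ℂ) :
    contr ℂ (normalCovariance L M fun ks => (fun ks' : FreqMomentum L M × Fin 2 => q ks'.1) ks /
        (1 + (fun ks' : FreqMomentum L M × Fin 2 => q ks'.1) ks * (fun ks' : FreqMomentum L M × Fin 2 => c ks'.1) ks)) =
      diagContr L M fun k => q k / (1 + q k * c k) :=
  contr_normalCovariance_eq_diagContr (L := L) (M := M) fun k => q k / (1 + q k * c k)

/-! ## §4 The dressed one-slice step: the two-leg part of the input resummed into the normal step covariance -/

/-- **The two-leg part of a conserving input action resummed into a normal step covariance (all degrees).**  `C = normalCovariance p`; `W` with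
the two-leg selection rules; `κ(k,σ) := 2·kernel W 2 (ψ̂⁺_{kσ},ψ̂⁻_{kσ})`; all `1 + p·κ ≠ 0`; `V′` without constant part; unit partition functions
`Z_C(presented (kernel W 2))`, `Z_{C̃}(V′)`, `C̃ = normalCovariance (p/(1 + pκ))`.  Then
`effAction C (V′ + presented (kernel W 2)) = effAction C (presented (kernel W 2)) + S_m (effAction C̃ V′)`, `m(X) = (1 + p(X₁)κ(X₁))⁻¹` —
`effAction_normalCovariance_add_diagQuadratic` (p521577) at the `hQ` of §2.  With `V′ := 𝒱 − presented (kernel 𝒱 2)` (§1: no two-leg kernel;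
`V′ + presented (kernel 𝒱 2) = 𝒱`) this is the (R1′) dressed step for the input `𝒱`. -/
theorem effAction_normalCovariance_add_twoLegPart (p : FreqMomentum L M × Fin 2 → ℂ) (W V' : HubbardGrassmann L M)
    (hplus : ∀ (q : FreqMomentum L M) (σ : Fin 2) (Y : HubbardFieldIdx L M), Y ≠ ((q, σ), 1) → kernel ℂ W 2 ![((q, σ), 0), Y] = 0)
    (hminus : ∀ (q : FreqMomentum L M) (σ : Fin 2) (Y : HubbardFieldIdx L M), Y ≠ ((q, σ), 0) → kernel ℂ W 2 ![((q, σ), 1), Y] = 0)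
    (hden : ∀ ks : FreqMomentum L M × Fin 2, 1 + p ks * (2 * kernel ℂ W 2 ![((ks, 0) : HubbardFieldIdx L M), (ks, 1)]) ≠ 0)
    (hV0 : constPart ℂ V' = 0)
    (hZQ : IsUnit (effPartitionFn ℂ (normalCovariance L M p) (presented ℂ (kernel ℂ W 2))))
    (hZV : IsUnit (effPartitionFn ℂ (normalCovariance L M fun ks =>
      p ks / (1 + p ks * (2 * kernel ℂ W 2 ![((ks, 0) : HubbardFieldIdx L M), (ks, 1)]))) V')) :
    effAction ℂ (normalCovariance L M p) (V' + presented ℂ (kernel ℂ W 2)) =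
      effAction ℂ (normalCovariance L M p) (presented ℂ (kernel ℂ W 2)) +
        ExteriorAlgebra.map (LinearMap.mulLeft ℂ fun X : HubbardFieldIdx L M =>
            (1 + p X.1 * (2 * kernel ℂ W 2 ![((X.1, 0) : HubbardFieldIdx L M), (X.1, 1)]))⁻¹)
          (effAction ℂ (normalCovariance L M fun ks =>
            p ks / (1 + p ks * (2 * kernel ℂ W 2 ![((ks, 0) : HubbardFieldIdx L M), (ks, 1)]))) V') :=
  effAction_normalCovariance_add_diagQuadratic p (fun ks => 2 * kernel ℂ W 2 ![((ks, 0) : HubbardFieldIdx L M), (ks, 1)]) hden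
    (presented_kernel_two_eq_sum_of_twoLeg W hplus hminus) hV0 hZQ hZV

/-- **The input splits**: `𝒱 = (𝒱 − presented (kernel 𝒱 2)) + presented (kernel 𝒱 2)`, the first summand without constant part (if `𝒱` has none)
and without two-leg kernel (§1). -/
theorem sub_presented_two_add (W : HubbardGrassmann L M) :
    (W - presented ℂ (kernel ℂ W 2)) + presented ℂ (kernel ℂ W 2) = W := sub_add_cancel W _

/-- `constPart (𝒱 − presented (kernel 𝒱 2)) = constPart 𝒱`. -/
theorem constPart_sub_presented_two (W : HubbardGrassmann L M) :
    constPart ℂ (W - presented ℂ (kernel ℂ W 2)) = constPart ℂ W := by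
  rw [map_sub, constPart_presented_two, sub_zero]

end Model

end Summit.HubbardSuperconductivity.HubbardSuperconductivity.Theorems.KLRegimeWick

end
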